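import Summits.Parity.GeneralizedHardyLittlewood.Theorems.PrimeLevelFamEdgeIdeaDeltasFloorDualDefs
import HarnessLib

/-!
# Route `PrimeLevelFamEdge` — TYPED IDEA DELTAS, deck 18c: K-L21-3 dual witnesses, v1.3 ERRATUM shapes (QUADRATIC-DECAY
# Parseval).  Deck 18b landed the seat's v1.2 (`IsDualWitness`, whose `parseval` field demands pointwise Poisson/Parseval
# for EVERY even `r ∈ C ∩ L¹` with integrable sides — a class on which pointwise Poisson summation can FAIL, Katznelson,
# *An Introduction to Harmonic Analysis* (2004) VI §1 p. 157 / Ex. 1.17 — so v1.2's `QuarterWitnessExists` is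
# over-constrained, plausibly uninhabited: seat ls-idea-lens-21 g2 self-erratum E-L21-3, critic F b26.3 CONCUR).  The gate
# is append-only («deprecate, don't mutate»), so the corrected v1.3 objects (seat's `Sketch_L21_DualWitness.lean` v1.3 sha16
# c4e73dda82806e71, F-verified) land HERE under the suffix `QD`, VERBATIM up to the renaming; deck 18b's v1.2 names stay as
# the STRONGER (over-constrained) variants, with `IsDualWitness.toQD` / `QuarterWitnessExists.toQD` recording v1.2 ⇒ v1.3.
# USE THE `QD` NAMES.  Typer ls-idea-typ-1 gen 3.

PROVED: `IsDualWitness.toQD`, `weakDuality_floorQD`, `weakDualityFloorQD_holds`, `IsDualWitnessQD.mono`,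
`heightWallLowerEdge_ofQD : QuarterWitnessExistsQD → HeightWallLowerEdge`, `QuarterWitnessExists.toQD`.
TYPED ONLY: `QuarterWitnessExistsQD`, `LaplaceNoTieAtAHQD`, `LaplaceDoorClosedBeyondTwoQD`, `RealisableWitnessQD`,
`RealisabilityDoorQD`, `QuarterWitnessRealisableQD`.
HONESTY: no exceptional-zero theorem (no Landau–Siegel / Siegel-zero exclusion, no Theorem 1–2 of arXiv:2211.02515, no repaired
Margin232) is proved here; nothing about ζ, the CI door or realisability is proved; typed ≠ proved; computed ≠ proved.
-/

namespace Summit.Parity.GeneralizedHardyLittlewood.Theorems.PrimeLevelFamEdgeIdeaDeltas.FloorDual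

open Literature.NumberTheory.LFunctions MeasureTheory
open scoped Real

/-! ### Dual witnesses with quadratic-decay Parseval (v1.3) -/

/-- A PAIR-LEVEL DUAL WITNESS for the height-`c` floor on `1 < |α| < B`: a positive even measure `ρ₂`
(pair correlation of a would-be zero process, intensity 1) with NO MASS on `|u| < ½` (no sub-half gaps),
a positive measure `ν` on `|α| > 1` (the form factor beyond the diagonal) dominating `c·Lebesgue` on
`1 < |α| < B`, and the PARSEVAL/EXPLICIT-FORMULA identity against every test function of the class with
Montgomery's `|α| + δ₀` on `[−1,1]`.  (For the lattice witnesses the identity is Poisson summation.) -/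
structure IsDualWitnessQD (ρ₂ ν : Measure ℝ) (c B : ℝ) : Prop where
  core : ρ₂ (Set.Ioo (-(1 / 2 : ℝ)) (1 / 2)) = 0
  offDiag : ν (Set.Icc (-1 : ℝ) 1) = 0
  floor : (ENNReal.ofReal c) • (volume.restrict (Set.Ioo (1 : ℝ) B ∪ Set.Ioo (-B) (-1))) ≤ ν
  /-- Montgomery pairing on `[−1,1]` written in BGMM's even normal form `r̂(0) + 2∫₀¹ α r̂(α) dα`.
  v1.3: demanded only for test functions with QUADRATIC DECAY of `r` and `r̂` (the decay fields of
  `IsFloorAdmissible`; every certificate of record) — for lattice / periodic witnesses the identity is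
  POINTWISE Poisson summation, which holds under `(1+|x|)^{-b}`, `b > 1`, decay of both `r` and `r̂`
  (Mathlib `Real.tsum_eq_tsum_fourier_of_rpow_decay`; decay of `r` plus summability of the dual
  samples already suffices, `…_of_summable`) but can FAIL for general `r ∈ C ∩ L¹` with both sides
  absolutely summable (Katznelson, *An Introduction to Harmonic Analysis* (3rd ed. 2004), VI §1 p. 157
  and Exercise 1.17); v1.2 quantified over that larger class and so over-constrained the witness. -/
  parseval : ∀ r : ℝ → ℝ, (∀ u, r (-u) = r u) → Continuous r → Integrable r →
    (∃ C : ℝ, ∀ u : ℝ, |r u| ≤ C / (1 + u ^ 2)) →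
    (∃ C : ℝ, ∀ α : ℝ, |BGMM2023.cosTransform r α| ≤ C / (1 + α ^ 2)) →
    Integrable r ρ₂ → Integrable (BGMM2023.cosTransform r) ν →
      r 0 + ∫ u, r u ∂ρ₂ =
        BGMM2023.cosTransform r 0 + (2 * ∫ α in (0 : ℝ)..1, α * BGMM2023.cosTransform r α)
          + ∫ α, BGMM2023.cosTransform r α ∂ν

/-- v1.2 ⇒ v1.3: a deck-18b witness (Parseval on the whole `C ∩ L¹` class) is a quadratic-decay witness. -/
theorem IsDualWitness.toQD {ρ₂ ν : Measure ℝ} {c B : ℝ} (hw : IsDualWitness ρ₂ ν c B) :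
    IsDualWitnessQD ρ₂ ν c B where
  core := hw.core
  offDiag := hw.offDiag
  floor := hw.floor
  parseval := fun r he hc hi _ _ hρ hν => hw.parseval r he hc hi hρ hν

/-- WEAK DUALITY (PROVED): a dual witness at height `c` on `(1,B)` forbids every one-sided certificate
at height `c`, any window `< ½` — three sign checks: `∫ r dρ₂ ≤ 0` (`r ≤ 0` on `|u| ≥ ½ > λ`),
`∫ r̂ dν ≥ 2c∫₁ᴮ r̂` (`r̂ ≥ 0` beyond 1, `ν ≥ c` there), `r(0) = 1`.  (`Continuous r̂` is automatic for
`r ∈ L¹`; kept as a hypothesis to stay elementary.) -/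
theorem weakDuality_floorQD {ρ₂ ν : Measure ℝ} {c B lam : ℝ} (hw : IsDualWitnessQD ρ₂ ν c B)
    (hc : 0 ≤ c) (hB : 1 ≤ B) (hlam : lam < 1 / 2) {r : ℝ → ℝ} (hr : IsFloorAdmissible r lam)
    (hrρ : Integrable r ρ₂) (hrν : Integrable (BGMM2023.cosTransform r) ν)
    (hcont : Continuous (BGMM2023.cosTransform r)) : cValueHeight r c B ≤ 0 := by
  set R := BGMM2023.cosTransform r with hR
  -- (1) the pair side is ≤ 0
  have h1 : ∫ u, r u ∂ρ₂ ≤ 0 := by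
    apply integral_nonpos_of_ae
    have hae : ∀ᵐ u ∂ρ₂, u ∉ Set.Ioo (-(1 / 2 : ℝ)) (1 / 2) := by
      rw [ae_iff]; simpa only [not_not, Set.setOf_mem_eq] using hw.core
    filter_upwards [hae] with u hu
    simp only [Set.mem_Ioo, not_and_or, not_lt] at hu
    have hu' : (1 / 2 : ℝ) ≤ |u| := by
      rcases hu with h | h
      · rw [abs_of_nonpos (by linarith)]; linarith
      · rw [abs_of_nonneg (by linarith)]; linarith
    exact hr.nonpos u (lt_of_lt_of_le hlam hu')
  -- (2) the form-factor side beyond the diagonal is ≥ the floor credit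
  have hnn : 0 ≤ᵐ[ν] R := by
    have hae : ∀ᵐ α ∂ν, α ∉ Set.Icc (-1 : ℝ) 1 := by
      rw [ae_iff]; simpa only [not_not, Set.setOf_mem_eq] using hw.offDiag
    filter_upwards [hae] with α hα
    simp only [Set.mem_Icc, not_and_or, not_le] at hα
    have hα' : (1 : ℝ) ≤ |α| := by
      rcases hα with h | h
      · rw [abs_of_nonpos (by linarith)]; linarith
      · rw [abs_of_nonneg (by linarith)]; linarith
    exact hr.transform_nonneg_tail α hα'
  have hS : ∫ α, R α ∂((ENNReal.ofReal c) • volume.restrict (Set.Ioo (1 : ℝ) B ∪ Set.Ioo (-B) (-1)))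
      ≤ ∫ α, R α ∂ν := integral_mono_measure hw.floor hnn hrν
  rw [integral_smul_measure, ENNReal.toReal_ofReal hc, smul_eq_mul] at hS
  have hIO : ∀ a b : ℝ, IntegrableOn R (Set.Ioo a b) volume := fun a b =>
    (hcont.integrableOn_Icc).mono_set Set.Ioo_subset_Icc_self
  have hunion : ∫ α in Set.Ioo (1 : ℝ) B ∪ Set.Ioo (-B) (-1), R α =
      (∫ α in Set.Ioo (1 : ℝ) B, R α) + ∫ α in Set.Ioo (-B) (-1), R α := by
    refine setIntegral_union ?_ measurableSet_Ioo (hIO _ _) (hIO _ _)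
    rw [Set.disjoint_iff]
    rintro x ⟨⟨h1x, -⟩, ⟨-, hx2⟩⟩
    linarith
  have hpos : ∫ α in Set.Ioo (1 : ℝ) B, R α = ∫ α in (1 : ℝ)..B, R α := by
    rw [intervalIntegral.integral_of_le hB, integral_Ioc_eq_integral_Ioo]
  have hnegside : ∫ α in Set.Ioo (-B) (-1), R α = ∫ α in (1 : ℝ)..B, R α := by
    have hB' : -B ≤ -1 := by linarith
    rw [← integral_Ioc_eq_integral_Ioo, ← intervalIntegral.integral_of_le hB']
    have : (fun α => R α) = fun α => R (-α) := by ext α; exact (cosTransform_neg r α).symm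
    calc ∫ α in (-B)..(-1), R α = ∫ α in (-B)..(-1), R (-α) := by
            exact intervalIntegral.integral_congr fun α _ => (cosTransform_neg r α).symm
      _ = ∫ α in (1 : ℝ)..B, R α := by
            rw [intervalIntegral.integral_comp_neg]; simp
  rw [hunion, hpos, hnegside] at hS
  -- (3) Montgomery pairing + r(0) = 1
  have h3 := hw.parseval r hr.even hr.continuous hr.integrable hr.decay hr.transform_decay hrρ hrν
  rw [hr.map_zero] at h3
  unfold cValueHeight BGMM2023.cValue
  linarith

/-- Statement form of weak duality (for the card's register). -/
def WeakDualityFloorQD : Prop :=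
  ∀ (ρ₂ ν : Measure ℝ) (c B lam : ℝ), IsDualWitnessQD ρ₂ ν c B → 0 ≤ c → 1 ≤ B → lam < 1 / 2 →
    ∀ r : ℝ → ℝ, IsFloorAdmissible r lam → Integrable r ρ₂ →
      Integrable (BGMM2023.cosTransform r) ν → Continuous (BGMM2023.cosTransform r) →
        cValueHeight r c B ≤ 0

/-- WEAK DUALITY (v1.3 class) packaged: PROVED. -/
theorem weakDualityFloorQD_holds : WeakDualityFloorQD :=
  fun _ _ _ _ _ hw hc hB hlam _ hr hrρ hrν hcont => weakDuality_floorQD hw hc hB hlam hr hrρ hrν hcont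

/-! ### The AH¼ existence statement and the lower edge of the height wall (v1.3 shapes) -/


/-- The AH¼ data as a dual witness: `ρ₂ = Σ_{k≥2} c_k (δ_{k/4} + δ_{−k/4})`, `ν = ` the 4-periodic
extension of `t·𝟙 + b δ_{±2} + (|α − 4j| + δ_{4j})` restricted to `|α| > 1`.  CONSTRUCTION statement
(typed; proof = Poisson summation on `¼ℤ` for the test class + `quarterCoeff_one` + `quarterWitnessNonneg`
+ tameness from the decay fields).  v1.2: tameness is part of the claim. -/
def QuarterWitnessExistsQD : Prop :=
  ∃ ρ₂ ν : Measure ℝ, IsDualWitnessQD ρ₂ ν quarterLevel 3 ∧ IsTameWitness ρ₂ ν ∧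
    ρ₂ = (Measure.sum fun k : ℕ =>
      (ENNReal.ofReal (quarterCoeff (k + 2))) •
        (Measure.dirac ((k + 2 : ℝ) / 4) + Measure.dirac (-((k + 2 : ℝ) / 4))))

/-- v1.2 ⇒ v1.3 for the AH¼ existence statement. -/
theorem QuarterWitnessExists.toQD (h : QuarterWitnessExists) : QuarterWitnessExistsQD := by
  obtain ⟨ρ₂, ν, hw, ht, hρ⟩ := h
  exact ⟨ρ₂, ν, hw.toQD, ht, hρ⟩


/-- MONOTONICITY of dual witnesses in the floor data (PROVED): lowering the height `c' ↦ c ≤ c'`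
and shrinking the range `B' ↦ B ≤ B'` keeps a witness a witness. -/
theorem IsDualWitnessQD.mono {ρ₂ ν : Measure ℝ} {c c' B B' : ℝ} (hw : IsDualWitnessQD ρ₂ ν c' B')
    (hcc' : c ≤ c') (hBB' : B ≤ B') : IsDualWitnessQD ρ₂ ν c B where
  core := hw.core
  offDiag := hw.offDiag
  floor := by
    refine le_trans ?_ hw.floor
    have hS : Set.Ioo (1 : ℝ) B ∪ Set.Ioo (-B) (-1) ⊆ Set.Ioo (1 : ℝ) B' ∪ Set.Ioo (-B') (-1) :=
      Set.union_subset_union (Set.Ioo_subset_Ioo le_rfl hBB')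
        (Set.Ioo_subset_Ioo (neg_le_neg hBB') le_rfl)
    have h1 : volume.restrict (Set.Ioo (1 : ℝ) B ∪ Set.Ioo (-B) (-1)) ≤
        volume.restrict (Set.Ioo (1 : ℝ) B' ∪ Set.Ioo (-B') (-1)) :=
      Measure.restrict_mono hS le_rfl
    have h2 : ENNReal.ofReal c ≤ ENNReal.ofReal c' := ENNReal.ofReal_le_ofReal hcc'
    rw [Measure.le_iff]
    intro s hs
    simp only [Measure.smul_apply, smul_eq_mul]
    exact mul_le_mul' h2 ((Measure.le_iff.1 h1) s hs)
  parseval := hw.parseval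

/-- COMPOSITION (PROVED from `QuarterWitnessExistsQD` ALONE, v1.2): monotonicity (`IsDualWitnessQD.mono`),
the negative-height case (for `c < 0` the floor credit `2c∫₁ᴮ r̂ ≤ 0` because `r̂ ≥ 0` beyond `1`, so the
level-`0` witness already kills the certificate) and the integrability side conditions (tameness, now
part of the existence statement) are all discharged. -/
theorem heightWallLowerEdge_ofQD (hQ : QuarterWitnessExistsQD) : HeightWallLowerEdge := by
  intro c B lam hc hB hlam hcert
  obtain ⟨hB1, r, hr, hpos⟩ := hcert
  obtain ⟨ρ₂, ν, hwit, htame, -⟩ := hQ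
  obtain ⟨hi1, hi2, hi3⟩ := htame r lam hr
  have ht0 : (0 : ℝ) ≤ quarterLevel := le_trans (by norm_num) seven_tenths_le_quarterLevel
  by_cases hc0 : 0 ≤ c
  · have hwit' : IsDualWitnessQD ρ₂ ν c B := hwit.mono hc hB
    have := weakDuality_floorQD hwit' hc0 hB1 hlam hr hi1 hi2 hi3
    linarith
  · have hw0 : IsDualWitnessQD ρ₂ ν 0 B := hwit.mono ht0 hB
    have h0 := weakDuality_floorQD hw0 le_rfl hB1 hlam hr hi1 hi2 hi3
    have hI : 0 ≤ ∫ α in (1 : ℝ)..B, BGMM2023.cosTransform r α := by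
      apply intervalIntegral.integral_nonneg hB1
      intro x hx
      exact hr.transform_nonneg_tail x (by rw [abs_of_nonneg (by linarith [hx.1])]; exact hx.1)
    have hcneg : c < 0 := lt_of_not_ge hc0
    have hle : cValueHeight r c B ≤ cValueHeight r 0 B := by
      unfold cValueHeight
      nlinarith
    linarith

/-! ### Laplace currencies and the realisability door (v1.3 shapes) -/

/-- COMPUTED CLAIM (LP over `(1/16)ℤ`- and `(1/24)ℤ`-supported pair measures, `c_k ≥ 0` verified on
`≥ 60` `k`-periods + residue-class asymptotics; files `lap1_m8_a*.json`, `lap1_m12_a*_N32.json`):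
hard-core-½ pair-level witnesses with Montgomery core carry Laplace mass
`Λ_w(0.3) = 0.90269`, `Λ_w(0.5) = 0.35602`, `Λ_w(0.7) = 0.16677`, `Λ_w(1) = 0.06254`, `Λ_w(1.25) = 0.03025`,
`Λ_w(1.5) = 0.015535`, `Λ_w(2) = 0.004656`, `Λ_w(2.5) = 0.001546`, `Λ_w(3) = 0.000543` — above
`Λ_AH(a)` at every listed `a` (NO TIE AT AH) and above `Λ_GUE(a)` for `a ∈ {2, 2.5, 3}`. -/
def LaplaceNoTieAtAHQD : Prop :=
  ∀ a ∈ ({0.3, 0.5, 0.7, 1, 1.25, 1.5, 2, 2.5, 3} : Set ℝ),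
    ∃ ρ₂ ν : Measure ℝ, IsDualWitnessQD ρ₂ ν 0 1 ∧ IsTameWitness ρ₂ ν ∧ laplaceTailAH a < laplaceMass ν a

/-- COMPUTED CLAIM, final at witness grade: for `a ≥ 2` (listed values) a hard-core-½ pair-level witness
EXCEEDS the pair-correlation-conjecture Laplace mass, so NO Laplace-floor certificate at or below the
PC value exists in any minorant class — the K-L21-2 door is CLOSED there (gen 0 had this solver-grade
for `a ≥ 1.5`; at `a ∈ {1.5, 1.75}` the witnesses stay below `Λ_GUE`: undecided at witness grade). -/
def LaplaceDoorClosedBeyondTwoQD : Prop :=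
  ∀ a ∈ ({2, 2.5, 3} : Set ℝ),
    ∃ ρ₂ ν : Measure ℝ, IsDualWitnessQD ρ₂ ν 0 1 ∧ IsTameWitness ρ₂ ν ∧ laplaceTailGUE a < laplaceMass ν a



/-- The REALISABLE dual value of the height door: a dual witness at height `c` on `(1,B)` whose `ρ₂` is the
pair correlation of an honest hard-core-½ point process (v1.2: and the pair is tame — without this the
junk `ν = ∞·𝟙_{|α|>1}` paired with AH's realisable `ρ₂` would satisfy the definition for every `c, B`
and make `RealisabilityDoorQD` vacuous). -/
def RealisableWitnessQD (c B : ℝ) : Prop :=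
  ∃ ρ₂ ν : Measure ℝ, IsDualWitnessQD ρ₂ ν c B ∧ IsTameWitness ρ₂ ν ∧ KLSRealisable (1 / 2) ρ₂

/-- THE REALISABILITY DOOR (typed TARGET; informal proof = local weak limits of the unfolded zero process
along `T → ∞` (tightness from `N(T)`), Montgomery's theorem for the limit's form factor on `[−1,1]`,
the floor passing to the limit as a measure inequality, and the contrapositive: if NO realisable witness
exists at height `c` on `(1,B)`, then under RH the floor input forces a positive proportion of gaps
`≤ λ` for some `λ < ½` (diagonal argument over `λ ↑ ½`), whence BGMM's `GapDensityPos`, the tree's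
`subnormalGapsHypothesis_of_gapDensityPos`, and the CI door).  Strictly WEAKER hypothesis than any LP
certificate (`HeightCertificate c B lam → ¬ RealisableWitnessQD c B` by weak duality), and EXACT: if a
realisable witness exists, no argument using only RH + Montgomery + the floor + "the zeros are a point
process" can open the door. -/
def RealisabilityDoorQD (c B : ℝ) : Prop :=
  RiemannHypothesis → ¬ RealisableWitnessQD c B →
    (∀ ε : ℝ, 0 < ε → ∀ᶠ T : ℝ in Filter.atTop, ∀ α : ℝ, 1 ≤ |α| → |α| ≤ B →
        c - ε ≤ montgomeryFormFactor α T) →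
      ∃ lam : ℝ, lam < 1 / 2 ∧ BGMM2023.GapDensityPos lam

/-- COMPUTED (finite-window LP hierarchy = KLS cone truncated to `n` consecutive sites of `(1/2m)ℤ`,
`l21g2_realize.py`; Yamada's variance condition `l21g2_yamada.py`): the AH¼ pair data passes every
window test for `n ≤ 18` quarter-sites and the `m = 3` floor witness (`t = 0.7551`) for `n ≤ 24`
sixth-sites; no Farkas cut (= KLS polynomial) was found.  CONJECTURE shape recorded for the critic: -/
def QuarterWitnessRealisableQD : Prop := RealisableWitnessQD quarterLevel 3

end Summit.Parity.GeneralizedHardyLittlewood.Theorems.PrimeLevelFamEdgeIdeaDeltas.FloorDual
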